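import Summits.ResolutionOfSingularities.ResolutionOfSingularities.Theorems.PurelyInseparableDim4LeafStep
import Summits.ResolutionOfSingularities.ResolutionOfSingularities.Theorems.PurelyInseparableDim4MohAlong
import HarnessLib
import HarnessLib.Audit.Tags

/-!
# Purely inseparable fourfolds — the «d = 0 LEAF» step at a point ALONG the centre: safe exactly
# when the MOVED state is still a leaf (cell res-dim4-pi, WORD #38 (a)(2), sequel)
# [OURS · counted 0 · a statement about OUR coordinate-centre frame, not about resolution]

Width seat `res-dim4-p-10` (g2).  `PurelyInseparableDim4LeafStep.leafStep_fibre` handles the replies of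
B in the FIBRE over the origin; the specimens file shows that replies ALONG the centre (`b = b' + c`,
`c` supported off `S`) can destroy the leaf property.  Here the exact positive statement for such
replies, through res-dim4-p-1's `MohAlong.step_add_eq_step_translate` (the step at `b' + c` is the step
at the fibre point `b'` of the state MOVED to the point `c` of the centre,
`s@c = (translate c F, r|_{c = 0}, exc|_{c = 0})`):

* `filter_le_of_mem_support_translate` — `x^{r|_{c=0}}` divides `translate c F` (always);
* `ordAlong_translate_le`, `least_of_moved` — the centre stays permissible of least cardinality for
  the moved state whenever the moved state is a leaf;
* **`leafStep_along`** — if the MOVED state is a leaf, i.e. `coeff_{r|_{c=0}} (translate c F) ≠ 0`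
  («the unit does not vanish at `c`», excludes specimens X0/X2) and `x^{r|_{c=0}}` is not a `q`-th
  power (excludes specimen X1), then every equimultiple reply `b' + c` yields a leaf with
  `|r'| < |r|_{c=0}| ≤ |r|`.

So along a cardinality-first branch a d = 0 leaf can stop being a leaf ONLY at a reply along the
centre whose moved state already fails one of the two checks.  Nothing here proves resolution of
singularities in dimension ≥ 4 / characteristic `p`; counted 0; AI work, weaker than expert review.
bears_on: LADDER-RESOLUTION:D157-DOOR2 (res-dim4-pi · WORD #38 (a)(2)). Supports
stmt-ResolutionOfSingularities-16155 (helper).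
-/

set_option linter.dupNamespace false

open MvPolynomial Finset

open scoped BigOperators

noncomputable section

namespace Summit.ResolutionOfSingularities.ResolutionOfSingularities.Theorems.PIDim4

namespace LeafStep

open Literature.AlgebraicGeometry.Resolution
open Literature.AlgebraicGeometry.Resolution.Hauser2010
open CentreBlowup

variable {σ : Type*} [Fintype σ] [DecidableEq σ] {K : Type*} [Field K] [DecidableEq K]

/-! ## 1. The moved state of a leaf -/

/-- `x^{r|_{c = 0}}` divides `translate c F` monomialwise whenever `x^r` divides `F`. [folklore] -/
theorem filter_le_of_mem_support_translate (c : σ → K) (s : CState σ K)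
    (hdiv : ∀ d ∈ s.F.support, s.r ≤ d) :
    ∀ d ∈ (PointBlowup.translate c s.F).support, (s.r.filter fun i => c i = 0) ≤ d := by
  intro d hd
  obtain ⟨e, he, -, hfix⟩ := MohAlong.exists_of_mem_support_translate c s.F hd
  refine Finsupp.le_def.mpr fun i => ?_
  rw [Finsupp.filter_apply]
  by_cases hci : c i = 0
  · rw [if_pos hci, hfix i hci]
    exact Finsupp.le_def.mp (hdiv e he) i
  · rw [if_neg hci]
    exact Nat.zero_le _

omit [Fintype σ] [DecidableEq σ] in
/-- On a coordinate set where `c` vanishes, `r|_{c=0}` and `r` have the same `S`-degree. [folklore] -/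
theorem degIn_filter_of_vanish {S : Finset σ} (c : σ → K) (hc : ∀ i ∈ S, c i = 0) (r : σ →₀ ℕ) :
    degIn S (r.filter fun i => c i = 0) = degIn S r :=
  Finset.sum_congr rfl fun i hi => by rw [Finsupp.filter_apply, if_pos (hc i hi)]

omit [Fintype σ] [DecidableEq σ] in
/-- `r|_{c=0} ≤ r`, so `degIn S' (r|_{c=0}) ≤ degIn S' r` for every `S'`. [folklore] -/
theorem degIn_filter_le (S' : Finset σ) (c : σ → K) (r : σ →₀ ℕ) :
    degIn S' (r.filter fun i => c i = 0) ≤ degIn S' r :=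
  degIn_le_degIn_of_le S' fun i => by
    rw [Finsupp.filter_apply]
    split_ifs
    · exact le_rfl
    · exact Nat.zero_le _

/-- **The centre stays cardinality-first for the moved leaf.** If `s` and its moved state `s@c` are both
leaves, every `S'` permissible for `s@c` is permissible for `s`; hence a least-cardinality permissible
centre of `s` on which `c` vanishes is one for `s@c`. [folklore] -/
theorem least_of_moved {q : ℕ} {S : Finset σ} (c : σ → K) (hc : ∀ i ∈ S, c i = 0) (s : CState σ K)
    (hdiv : ∀ d ∈ s.F.support, s.r ≤ d) (hd0 : coeff s.r s.F ≠ 0)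
    (hm0 : coeff (s.r.filter fun i => c i = 0) (PointBlowup.translate c s.F) ≠ 0)
    (hperm : (q : ℕ∞) ≤ ordAlong S s.F)
    (hleast : ∀ S' : Finset σ, S'.Nonempty → (q : ℕ∞) ≤ ordAlong S' s.F → S.card ≤ S'.card) :
    (q : ℕ∞) ≤ ordAlong S (PointBlowup.translate c s.F) ∧
      ∀ S' : Finset σ, S'.Nonempty → (q : ℕ∞) ≤ ordAlong S' (PointBlowup.translate c s.F) →
        S.card ≤ S'.card := by
  have hdivm := filter_le_of_mem_support_translate c s hdiv
  have hm : ∀ S', ordAlong S' (PointBlowup.translate c s.F) =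
      (degIn S' (s.r.filter fun i => c i = 0) : ℕ∞) := fun S' =>
    ordAlong_eq_degIn S' (⟨PointBlowup.translate c s.F, s.r.filter fun i => c i = 0, s.exc⟩ :
      CState σ K) hdivm hm0
  refine ⟨?_, fun S' hS' hq' => hleast S' hS' ?_⟩
  · rw [hm S, degIn_filter_of_vanish c hc, ← ordAlong_eq_degIn S s hdiv hd0]
    exact hperm
  · rw [hm S'] at hq'
    rw [ordAlong_eq_degIn S' s hdiv hd0]
    exact le_trans hq' (by exact_mod_cast degIn_filter_le S' c s.r)

/-- The point transform at `b' + c` is the point transform at the fibre point `b'` of the moved state.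
[folklore] -/
theorem pointTransform_add {q : ℕ} {S : Finset σ} {j : σ} (hj : j ∈ S) (b' c : σ → K)
    (hc : ∀ i ∈ S, c i = 0) (s : CState σ K) :
    pointTransform q S j (b' + c) s =
      pointTransform q S j b' ⟨PointBlowup.translate c s.F, s.r.filter fun i => c i = 0,
        s.exc.filter fun i => c i = 0⟩ := by
  unfold pointTransform
  rw [MohAlong.chartTransform_translate hj q c hc, MohAlong.translate_translate]

/-! ## 2. The leaf step at a point along the centre -/

/-- **LEAF STEP ALONG THE CENTRE.** Leaf `s`, cardinality-first permissible centre `S`, chart `j ∈ S`,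
reply `b' + c` with `b'` in the fibre (`b'_j = 0`, `b' = 0` off `S`) and `c` along the centre (`c = 0`
on `S`), equimultiple.  If the MOVED state `s@c` is still a leaf — `coeff_{r|_{c=0}} (translate c F) ≠ 0`
(the unit does not vanish at `c`) and `x^{r|_{c=0}}` is not a `q`-th power — then the successor
`step q S j (b' + c) s` is a leaf and `|r'| < |r|_{c=0}| ≤ |r|`. Both extra hypotheses are necessary
(specimens X0/X2, resp. X1, of `PurelyInseparableDim4LeafStepSpecimens`). [OURS · counted 0] [folklore] -/
theorem leafStep_along {q : ℕ} (hq : 0 < q) {S : Finset σ} {j : σ} (hj : j ∈ S) (b' c : σ → K)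
    (hb'j : b' j = 0) (hb' : ∀ i, i ∉ S → b' i = 0) (hc : ∀ i ∈ S, c i = 0) (s : CState σ K)
    (hdiv : ∀ d ∈ s.F.support, s.r ≤ d) (hd0 : coeff s.r s.F ≠ 0)
    (hperm : (q : ℕ∞) ≤ ordAlong S s.F)
    (hleast : ∀ S' : Finset σ, S'.Nonempty → (q : ℕ∞) ≤ ordAlong S' s.F → S.card ≤ S'.card)
    (hm0 : coeff (s.r.filter fun i => c i = 0) (PointBlowup.translate c s.F) ≠ 0)
    (hmcl : ¬ ∀ i, q ∣ (s.r.filter fun i => c i = 0) i)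
    (heq : IsEquimultiplePoint q S j (b' + c) s) :
    (∀ d ∈ (step q S j (b' + c) s).F.support, (step q S j (b' + c) s).r ≤ d) ∧
      coeff (step q S j (b' + c) s).r (step q S j (b' + c) s).F ≠ 0 ∧
      (¬ ∀ i, q ∣ (step q S j (b' + c) s).r i) ∧
      (step q S j (b' + c) s).r.degree < (s.r.filter fun i => c i = 0).degree ∧
      (step q S j (b' + c) s).r.degree < s.r.degree := by
  set m : CState σ K := ⟨PointBlowup.translate c s.F, s.r.filter fun i => c i = 0,
    s.exc.filter fun i => c i = 0⟩ with hmdef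
  have hstep : step q S j (b' + c) s = step q S j b' m :=
    MohAlong.step_add_eq_step_translate q hj b' c hb' hc s
  have heqm : IsEquimultiplePoint q S j b' m := fun d hd hdq => by
    have h := heq d hd hdq
    rwa [pointTransform_add hj b' c hc s] at h
  obtain ⟨hpermm, hleastm⟩ := least_of_moved c hc s hdiv hd0 hm0 hperm hleast
  obtain ⟨h1, h2, h3, h4⟩ := leafStep_fibre hq hj hb'j hb' m
    (filter_le_of_mem_support_translate c s hdiv) hm0 hmcl hpermm hleastm heqm
  rw [hstep]
  refine ⟨h1, h2, h3, h4, lt_of_lt_of_le h4 (PointBlowup.degree_le_degree_of_le fun i => ?_)⟩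
  change (s.r.filter fun i => c i = 0) i ≤ s.r i
  rw [Finsupp.filter_apply]
  split_ifs
  · exact le_rfl
  · exact Nat.zero_le _

omit [Fintype σ] [DecidableEq K] in
/-- **Every reply splits** as fibre part plus centre part: for `b` with `b_j = 0`,
`b = S.piecewise b 0 + S.piecewise 0 b` with the first summand in the fibre and the second along the
centre; so `leafStep_along` covers every reply of the frame's `Edge`. [folklore] -/
theorem piecewise_add_piecewise (S : Finset σ) (b : σ → K) :
    S.piecewise b (0 : σ → K) + S.piecewise (0 : σ → K) b = b := by
  funext i
  by_cases hi : i ∈ S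
  · rw [Pi.add_apply, Finset.piecewise_eq_of_mem _ _ _ hi, Finset.piecewise_eq_of_mem _ _ _ hi,
      Pi.zero_apply, add_zero]
  · rw [Pi.add_apply, Finset.piecewise_eq_of_notMem _ _ _ hi, Finset.piecewise_eq_of_notMem _ _ _ hi,
      Pi.zero_apply, zero_add]

end LeafStep

end Summit.ResolutionOfSingularities.ResolutionOfSingularities.Theorems.PIDim4

end
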